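import Mathlib
import Summits.Ventures.PercRepro2.RowC1DetHFresh
import Summits.Ventures.PercRepro2.RowC1Star

/-!
# The repulsion sign of (★): `P(b ∈ K₂ | o ∈ L) ≤ P(b ∈ K₂ | o rootless)` (blind cell PercRepro2, p2 g32;
proofs/P2-G32-STAR.md §7)

With `Q = {a₁ ↮ a₂}`, `oL = {o ↔ a₁}`, `oN = {o ∉ C(a₁) ∪ C(a₂)}` and `K₂ = C_{G−o}(a₂)`:

  **`condK2_oL_le_oN`: `P(Q, oL, b ∈ K₂) · P(Q, oN) ≤ P(Q, oL) · P(Q, oN, b ∈ K₂)`.**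

Proof. Explore the cluster `B = C(a₂)`; on `{a₂ ↮ a₁, a₂ ↮ o}` the status of `o` is decided in the
fresh graph `G ∖ B` (`γ(B) = P_{G∖B}(o ↔ a₁)`, antitone in `B`) and `b ∈ K₂` is `b ∈ B`
(`conn_of_conn_of_not_connDel`).  After the expansions the claim is
`E[1_b γ 1_R]·E[1_R] ≤ E[γ 1_R]·E[1_b 1_R]`, i.e. `Cov(γ, 1[b ∈ B]) ≤ 0` under the conditioning
`R = {a₂ ↮ {a₁, o}}` — the functional BHK inequality `bhk_induced` for the cluster of `a₂` with the
avoidance set `{a₁, o}` and the monotone functionals `1 − γ`, `1[b ∈ ·]`.  Std axioms.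
-/

namespace Summit.Ventures.PercRepro2

namespace RowC1

section OLN

open Classical

variable {V : Type*} {E : Type*} [Fintype E] [DecidableEq E] [Fintype V] [DecidableEq V]
  {R : Type*} [CommRing R] [LinearOrder R] [IsStrictOrderedRing R]

/-- The family `{C : o ∉ C}`. -/
def avoidO (o : V) : Set (Set V) := {C : Set V | o ∉ C}

/-- The family `{C : o ∉ C ∧ b ∈ C}`. -/
def avoidOmemB (o b : V) : Set (Set V) := {C : Set V | o ∉ C ∧ b ∈ C}

/-! ### The four events as exploration events of the cluster of `a₂` -/

omit [Fintype E] [DecidableEq E] in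
/-- `{Q, o ∈ L, b ∈ K₂}` as an exploration event. -/
lemma ev_oL_K2 (ends : E → Sym2 V) (a₁ a₂ o b : V) :
    connEvent ends a₁ o ∩ connDelEvent ends {o} b a₂ ∩ (connEvent ends a₁ a₂)ᶜ =
      clusterInEvent ends a₂ (avoidOmemB o b) ∩ clusterInEvent ends a₁ {C : Set V | o ∈ C} ∩
        (connEvent ends a₂ a₁)ᶜ := by
  ext ω
  constructor
  · rintro ⟨⟨ho, hb⟩, hQ⟩
    have ho' : Conn ends ω a₁ o := ho
    have hQ' : ¬ Conn ends ω a₁ a₂ := hQ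
    refine ⟨⟨⟨fun h => hQ' (conn_trans ho' (conn_symm h)), ?_⟩, ho'⟩, fun h => hQ' (conn_symm h)⟩
    exact conn_symm (connDelEvent_subset_connEvent ends {o} b a₂ hb)
  · rintro ⟨⟨⟨hoC, hbC⟩, ho⟩, hQ⟩
    have hbC' : Conn ends ω a₂ b := hbC
    have hoC' : ¬ Conn ends ω a₂ o := hoC
    have hQ' : ¬ Conn ends ω a₂ a₁ := hQ
    refine ⟨⟨ho, ?_⟩, fun h => hQ' (conn_symm h)⟩
    by_contra hdel
    exact hoC' (conn_symm (conn_of_conn_of_not_connDel (conn_symm hbC') hdel))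

omit [Fintype E] [DecidableEq E] [Fintype V] [DecidableEq V] in
/-- `{Q, o ∈ L}` as an exploration event. -/
lemma ev_oL (ends : E → Sym2 V) (a₁ a₂ o : V) :
    connEvent ends a₁ o ∩ (connEvent ends a₁ a₂)ᶜ =
      clusterInEvent ends a₂ (avoidO o) ∩ clusterInEvent ends a₁ {C : Set V | o ∈ C} ∩
        (connEvent ends a₂ a₁)ᶜ := by
  ext ω
  constructor
  · rintro ⟨ho, hQ⟩
    have ho' : Conn ends ω a₁ o := ho
    have hQ' : ¬ Conn ends ω a₁ a₂ := hQ
    exact ⟨⟨fun h => hQ' (conn_trans ho' (conn_symm h)), ho'⟩, fun h => hQ' (conn_symm h)⟩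
  · rintro ⟨⟨_, ho⟩, hQ⟩
    have hQ' : ¬ Conn ends ω a₂ a₁ := hQ
    exact ⟨ho, fun h => hQ' (conn_symm h)⟩

omit [Fintype E] [DecidableEq E] [Fintype V] [DecidableEq V] in
/-- `{Q, o rootless}` as an exploration event. -/
lemma ev_oN (ends : E → Sym2 V) (a₁ a₂ o : V) :
    (connEvent ends a₁ o ∪ connEvent ends a₂ o)ᶜ ∩ (connEvent ends a₁ a₂)ᶜ =
      clusterInEvent ends a₂ (avoidO o) ∩ clusterInEvent ends a₁ {C : Set V | o ∉ C} ∩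
        (connEvent ends a₂ a₁)ᶜ := by
  ext ω
  constructor
  · rintro ⟨ho, hQ⟩
    simp only [Set.mem_compl_iff, Set.mem_union, not_or] at ho
    have hQ' : ¬ Conn ends ω a₁ a₂ := hQ
    exact ⟨⟨ho.2, ho.1⟩, fun h => hQ' (conn_symm h)⟩
  · rintro ⟨⟨hoC, ho⟩, hQ⟩
    have hQ' : ¬ Conn ends ω a₂ a₁ := hQ
    refine ⟨?_, fun h => hQ' (conn_symm h)⟩
    simp only [Set.mem_compl_iff, Set.mem_union, not_or]
    exact ⟨ho, hoC⟩

omit [Fintype E] [DecidableEq E] in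
/-- `{Q, o rootless, b ∈ K₂}` as an exploration event. -/
lemma ev_oN_K2 (ends : E → Sym2 V) (a₁ a₂ o b : V) :
    (connEvent ends a₁ o ∪ connEvent ends a₂ o)ᶜ ∩ connDelEvent ends {o} b a₂ ∩
        (connEvent ends a₁ a₂)ᶜ =
      clusterInEvent ends a₂ (avoidOmemB o b) ∩ clusterInEvent ends a₁ {C : Set V | o ∉ C} ∩
        (connEvent ends a₂ a₁)ᶜ := by
  ext ω
  constructor
  · rintro ⟨⟨ho, hb⟩, hQ⟩
    simp only [Set.mem_compl_iff, Set.mem_union, not_or] at ho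
    have hQ' : ¬ Conn ends ω a₁ a₂ := hQ
    refine ⟨⟨⟨ho.2, ?_⟩, ho.1⟩, fun h => hQ' (conn_symm h)⟩
    exact conn_symm (connDelEvent_subset_connEvent ends {o} b a₂ hb)
  · rintro ⟨⟨⟨hoC, hbC⟩, ho⟩, hQ⟩
    have hbC' : Conn ends ω a₂ b := hbC
    have hoC' : ¬ Conn ends ω a₂ o := hoC
    have hQ' : ¬ Conn ends ω a₂ a₁ := hQ
    refine ⟨⟨?_, ?_⟩, fun h => hQ' (conn_symm h)⟩
    · simp only [Set.mem_compl_iff, Set.mem_union, not_or]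
      exact ⟨ho, hoC⟩
    · by_contra hdel
      exact hoC' (conn_symm (conn_of_conn_of_not_connDel (conn_symm hbC') hdel))

/-! ### The fresh probability of `o ↔ a₁` in `G ∖ B`, and its complement -/

omit [Fintype V] [DecidableEq V] [LinearOrder R] [IsStrictOrderedRing R] in
/-- `P_{G∖B}(o ∉ C(a₁)) = 1 − P_{G∖B}(o ∈ C(a₁))`. -/
lemma delClusterProb_notMem_eq (p : E → R) (ends : E → Sym2 V) (a₁ o : V) (B : Set V) :
    delClusterProb p ends a₁ {C : Set V | o ∉ C} B = 1 - delClusterProb p ends a₁ {C : Set V | o ∈ C} B := by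
  unfold delClusterProb
  rw [← prob_compl]
  rfl

/-! ### The avoidance indicator `1[a₁ ∉ B, o ∉ B]` -/

/-- `I(ω) = 1[o ∉ C(a₂)]·1[a₂ ↮ a₁]`: the indicator of `{a₂ ↮ a₁, a₂ ↮ o}`. -/
noncomputable def avoidIndO (ends : E → Sym2 V) (a₁ a₂ o : V) (ω : Config E) : R :=
  (avoidO o).indicator 1 (cluster ends ω a₂) * ((connEvent ends a₂ a₁)ᶜ).indicator 1 ω

omit [Fintype E] [DecidableEq E] [Fintype V] [DecidableEq V] in
/-- `0 ≤ I`. -/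
lemma avoidIndO_nonneg (ends : E → Sym2 V) (a₁ a₂ o : V) (ω : Config E) :
    (0 : R) ≤ avoidIndO ends a₁ a₂ o ω :=
  mul_nonneg (Set.indicator_apply_nonneg fun _ => zero_le_one)
    (Set.indicator_apply_nonneg fun _ => zero_le_one)

omit [Fintype E] [DecidableEq E] [LinearOrder R] [IsStrictOrderedRing R] in
/-- `I` is the indicator of `R^{univ}_{{a₁, o}}` for the cluster of `a₂`. -/
lemma REvent_indicator_eq_avoidIndO (ends : E → Sym2 V) (a₁ a₂ o : V) (ω : Config E) :
    (REvent ends Finset.univ a₂ {a₁, o}).indicator (1 : Config E → R) ω =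
      avoidIndO ends a₁ a₂ o ω := by
  unfold avoidIndO
  by_cases h : ω ∈ REvent ends Finset.univ a₂ {a₁, o}
  · rw [Set.indicator_of_mem h, Pi.one_apply]
    have h' : ∀ x ∈ ({a₁, o} : Finset V), ¬ Conn ends ω a₂ x := by
      intro x hx
      have := h x hx
      rwa [Finset.coe_univ, induced_univ] at this
    have hQ : ω ∈ (connEvent ends a₂ a₁)ᶜ := h' a₁ (by simp)
    have hU : cluster ends ω a₂ ∈ avoidO o := h' o (by simp)
    rw [Set.indicator_of_mem hU, Set.indicator_of_mem hQ]
    simp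
  · rw [Set.indicator_of_notMem h]
    by_cases hQ : ω ∈ (connEvent ends a₂ a₁)ᶜ
    · by_cases hU : cluster ends ω a₂ ∈ avoidO o
      · exfalso
        apply h
        intro x hx
        rw [Finset.coe_univ, induced_univ]
        simp only [Finset.mem_insert, Finset.mem_singleton] at hx
        rcases hx with rfl | rfl
        · exact hQ
        · exact hU
      · rw [Set.indicator_of_notMem hU, zero_mul]
    · rw [Set.indicator_of_notMem hQ, mul_zero]

omit [Fintype E] [DecidableEq E] [Fintype V] [DecidableEq V] [LinearOrder R] [IsStrictOrderedRing R] in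
/-- `1_{avoidOmemB}(C) = 1[b ∈ C] · 1_{avoidO}(C)`. -/
lemma indicator_avoidOmemB (o b : V) (C : Set V) :
    (avoidOmemB o b).indicator (1 : Set V → R) C =
      {C' : Set V | b ∈ C'}.indicator (1 : Set V → R) C * (avoidO o).indicator 1 C := by
  by_cases hb : b ∈ C <;> by_cases ho : o ∈ C
  · have h1 : C ∉ avoidOmemB o b := fun h => h.1 ho
    have h2 : C ∉ avoidO o := fun h => h ho
    simp [Set.indicator_of_notMem h1, Set.indicator_of_notMem h2]
  · have h1 : C ∈ avoidOmemB o b := ⟨ho, hb⟩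
    have h2 : C ∈ avoidO o := ho
    have h3 : C ∈ {C' : Set V | b ∈ C'} := hb
    simp [Set.indicator_of_mem h1, Set.indicator_of_mem h2, Set.indicator_of_mem h3]
  · have h1 : C ∉ avoidOmemB o b := fun h => hb h.2
    have h3 : C ∉ {C' : Set V | b ∈ C'} := hb
    simp [Set.indicator_of_notMem h1, Set.indicator_of_notMem h3]
  · have h1 : C ∉ avoidOmemB o b := fun h => hb h.2
    have h3 : C ∉ {C' : Set V | b ∈ C'} := hb
    simp [Set.indicator_of_notMem h1, Set.indicator_of_notMem h3]

/-! ### The BHK step and the theorem -/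

/-- **The BHK step**: with `γ = P_{G∖B}(o ↔ a₁)` and `I` the avoidance indicator,
`E[(1 − γ) I]·E[1_b I] ≤ E[(1 − γ) 1_b I]·E[I]`. -/
theorem bhk_oL_step (p : E → R) (hp : IsProbVec p) (ends : E → Sym2 V) (a₁ a₂ o b : V) :
    expect p (fun ω => (1 - delClusterProb p ends a₁ {C : Set V | o ∈ C} (cluster ends ω a₂)) *
        avoidIndO ends a₁ a₂ o ω) *
      expect p (fun ω => {C : Set V | b ∈ C}.indicator 1 (cluster ends ω a₂) *
        avoidIndO ends a₁ a₂ o ω) ≤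
    expect p (fun ω => (1 - delClusterProb p ends a₁ {C : Set V | o ∈ C} (cluster ends ω a₂)) *
        {C : Set V | b ∈ C}.indicator 1 (cluster ends ω a₂) * avoidIndO ends a₁ a₂ o ω) *
      expect p (fun ω => avoidIndO ends a₁ a₂ o ω) := by
  have hup : IsUpperSet {C : Set V | o ∈ C} := fun _ _ h hx => h hx
  have hF₁ : Monotone (fun B : Set V => 1 - delClusterProb p ends a₁ {C : Set V | o ∈ C} B) :=
    fun B B' h => sub_le_sub_left (delClusterProb_anti p hp ends a₁ hup h) 1
  have hF₂ : Monotone (fun B : Set V => {C : Set V | b ∈ C}.indicator (1 : Set V → R) B) := by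
    intro B B' h
    show {C : Set V | b ∈ C}.indicator (1 : Set V → R) B ≤ {C : Set V | b ∈ C}.indicator 1 B'
    by_cases hb : b ∈ B
    · have hb' : b ∈ B' := h hb
      rw [Set.indicator_of_mem (show B ∈ {C : Set V | b ∈ C} from hb),
        Set.indicator_of_mem (show B' ∈ {C : Set V | b ∈ C} from hb')]
      exact le_rfl
    · rw [Set.indicator_of_notMem (show B ∉ {C : Set V | b ∈ C} from hb)]
      exact Set.indicator_apply_nonneg fun _ => zero_le_one
  have hF₁0 : ∀ B : Set V, 0 ≤ 1 - delClusterProb p ends a₁ {C : Set V | o ∈ C} B :=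
    fun B => sub_nonneg.2 (delClusterProb_le_one p hp ends a₁ _ B)
  have hF₂0 : ∀ B : Set V, (0 : R) ≤ {C : Set V | b ∈ C}.indicator 1 B :=
    fun B => Set.indicator_apply_nonneg fun _ => zero_le_one
  have h := bhk_induced p hp ends a₂ hF₁ hF₂ hF₁0 hF₂0 Finset.univ {a₁, o} {a₁, o}
    (Finset.subset_univ _) (Finset.subset_univ _)
  simp only [Finset.inter_self, Finset.union_self] at h
  have e1 : ∀ F : Set V → R, clusterObs ends Finset.univ a₂ F *
      (REvent ends Finset.univ a₂ {a₁, o}).indicator 1 =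
      fun ω => F (cluster ends ω a₂) * avoidIndO ends a₁ a₂ o ω := by
    intro F
    funext ω
    simp only [Pi.mul_apply, clusterObs_apply, clusterIn_univ, REvent_indicator_eq_avoidIndO]
  have e2 : prob p (REvent ends Finset.univ a₂ {a₁, o}) =
      expect p (fun ω => avoidIndO ends a₁ a₂ o ω) := by
    rw [prob_eq_expect_indicator]
    unfold expect
    refine Finset.sum_congr rfl fun ω _ => ?_
    rw [REvent_indicator_eq_avoidIndO]
  rw [e1, e1, e1, e2] at h
  simpa only [Pi.mul_apply] using h

/-- **The repulsion sign of (★)**: `P(Q, o ∈ L, b ∈ K₂) · P(Q, o rootless) ≤ P(Q, o ∈ L) · P(Q, o rootless, b ∈ K₂)`,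
i.e. `P(b ∈ K₂ | Q, o ∈ L) ≤ P(b ∈ K₂ | Q, o rootless)` (`K₂ = C_{G−o}(a₂)`). -/
theorem condK2_oL_le_oN (p : E → R) (hp : IsProbVec p) (ends : E → Sym2 V) (a₁ a₂ o b : V) :
    prob p (connEvent ends a₁ o ∩ connDelEvent ends {o} b a₂ ∩ (connEvent ends a₁ a₂)ᶜ) *
        prob p ((connEvent ends a₁ o ∪ connEvent ends a₂ o)ᶜ ∩ (connEvent ends a₁ a₂)ᶜ) ≤
      prob p (connEvent ends a₁ o ∩ (connEvent ends a₁ a₂)ᶜ) *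
        prob p ((connEvent ends a₁ o ∪ connEvent ends a₂ o)ᶜ ∩ connDelEvent ends {o} b a₂ ∩
          (connEvent ends a₁ a₂)ᶜ) := by
  rw [ev_oL_K2, ev_oN, ev_oL, ev_oN_K2, prob_clusterIn_inter_eq_expect,
    prob_clusterIn_inter_eq_expect, prob_clusterIn_inter_eq_expect, prob_clusterIn_inter_eq_expect]
  simp only [delClusterProb_notMem_eq]
  -- rewrite the integrands with `γ`, `1_b` and `I`
  set γ : Config E → R := fun ω => delClusterProb p ends a₁ {C : Set V | o ∈ C} (cluster ends ω a₂)
    with hγ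
  set ι : Config E → R := fun ω => {C : Set V | b ∈ C}.indicator 1 (cluster ends ω a₂) with hι
  set I : Config E → R := fun ω => avoidIndO ends a₁ a₂ o ω with hI
  have r1 : (fun ω => (avoidOmemB o b).indicator 1 (cluster ends ω a₂) * γ ω *
      ((connEvent ends a₂ a₁)ᶜ).indicator 1 ω) = fun ω => ι ω * γ ω * I ω := by
    funext ω
    simp only [hγ, hι, hI, avoidIndO, indicator_avoidOmemB]
    ring
  have r2 : (fun ω => (avoidO o).indicator 1 (cluster ends ω a₂) * (1 - γ ω) *
      ((connEvent ends a₂ a₁)ᶜ).indicator 1 ω) = fun ω => (1 - γ ω) * I ω := by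
    funext ω
    simp only [hγ, hI, avoidIndO]
    ring
  have r3 : (fun ω => (avoidO o).indicator 1 (cluster ends ω a₂) * γ ω *
      ((connEvent ends a₂ a₁)ᶜ).indicator 1 ω) = fun ω => γ ω * I ω := by
    funext ω
    simp only [hγ, hI, avoidIndO]
    ring
  have r4 : (fun ω => (avoidOmemB o b).indicator 1 (cluster ends ω a₂) * (1 - γ ω) *
      ((connEvent ends a₂ a₁)ᶜ).indicator 1 ω) = fun ω => (1 - γ ω) * ι ω * I ω := by
    funext ω
    simp only [hγ, hι, hI, avoidIndO, indicator_avoidOmemB]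
    ring
  rw [r1, r2, r3, r4]
  have key := bhk_oL_step p hp ends a₁ a₂ o b
  simp only [← hI] at key
  -- expansions
  have x1 : expect p (fun ω => (1 - γ ω) * I ω) = expect p I - expect p (fun ω => γ ω * I ω) :=
    expect_one_sub_mul p γ I
  have x2 : expect p (fun ω => (1 - γ ω) * ι ω * I ω) =
      expect p (fun ω => ι ω * I ω) - expect p (fun ω => γ ω * ι ω * I ω) :=
    expect_one_sub_mul_mul p γ ι I
  have x3 : (fun ω => ι ω * γ ω * I ω) = fun ω => γ ω * ι ω * I ω := by
    funext ω; ring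
  rw [x1, x2] at key
  rw [x1, x2, x3]
  nlinarith [key]

end OLN

end RowC1

end Summit.Ventures.PercRepro2
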